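import Mathlib
import HarnessLib
import Summits.Ventures.LatticeQCDFlow.Exactness.SphereGeodesicKick
import Summits.Ventures.LatticeQCDFlow.Exactness.SphereGeodesicDrift

/-!
# The leading-order trivializing kick IS the exact geodesic drift for unit time with the tangential field as momentum

HONEST FRAMING: exact (Metropolis-corrected) sampling algorithms for lattice gauge theory;
figures of merit are autocorrelation/cost numbers at stated couplings and volumes; no
continuum-physics claim.

Venture `LatticeQCDFlow` (cell pub-lqcd), topic `Exactness`; FANOUT row 7 (`s0-cpn-null`: the
S0-D1 rung — 2D CP⁹, Lüscher's LO trivializing map inside HMC, Engel–Schaefer 2011).  NEW WORK of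
the cell (a one-line identity in a real inner product space) joining two of row 7's files:
`Exactness/SphereGeodesicKick.lean` (`tangentKick J x = J − ⟪J, x⟫ x`, `geodesicKick c J x` =
E–S eq. (17)) and `Exactness/SphereGeodesicDrift.lean` (`geodesicDrift τ (x, π)` = E–S eq. (11),
the exact geodesic motion used by the molecular dynamics).  Nothing is cited as a fact.  Printed
counterpart, NAMED ONLY: Engel–Schaefer, Comput. Phys. Commun. 182 (2011) 2107, eqs. (11) and (17).

## Content

* **`geodesicKick_eq_fst_geodesicDrift`** — for every `c`, `J`, `x`:
  `geodesicKick c J x = (geodesicDrift 1 (x, c • tangentKick J x)).1`.  The single-site LO step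
  ("move `x` along the great circle towards the local field by the arc `ε_s c |p|`") is the
  position after unit time of the EXACT free motion on the sphere started at `x` with momentum
  `c • p`, `p` the tangential part of `J` — the same closed-form geodesic the HMC drift uses.  So
  the two printed formulas are one map of the tangent bundle read twice, and everything proved for
  the drift's position component (`SphereGeodesicDrift.norm_fst_geodesicDrift`: stays on the
  sphere) is inherited by the kick, and conversely.
* `geodesicKick_eq_fst_geodesicDrift'` — the same with the time and the constant exchanged:
  `geodesicKick c J x = (geodesicDrift c (x, tangentKick J x)).1` (flow for time `c = ε_s c_map`
  with momentum `p`): the Euler step of the LO flow in the site variable is exact geodesic motion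
  for the step's duration, which is why `|x| = 1` is preserved to machine precision in the code.

NOT CLAIMED: anything about several sites / the sweep (that is `CheckerboardSweep.lean`), the
Jacobian (that is `KickAngleJacobian.lean`), or dynamics.
-/

noncomputable section

namespace Summit.Ventures.LatticeQCDFlow.Exactness

open Real
open scoped InnerProductSpace

variable {V : Type*} [NormedAddCommGroup V] [InnerProductSpace ℝ V]

/-- `sin (|c| r) / (|c| r) * c = sin (c r) / r` for all real `c`, `r` (with `0/0 = 0`): the scalar
identity behind reading the kick as a unit-time drift. -/
theorem sin_abs_mul_div_mul (c r : ℝ) : sin (|c| * r) / (|c| * r) * c = sin (c * r) / r := by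
  rcases eq_or_ne r 0 with hr | hr
  · subst hr; simp
  rcases eq_or_ne c 0 with hc | hc
  · subst hc; simp
  rcases le_or_gt 0 c with h | h
  · rw [abs_of_nonneg h]
    field_simp
  · rw [abs_of_neg h, neg_mul, sin_neg]
    field_simp

/-- **The LO kick is the unit-time geodesic drift with momentum `c • p`.**  For every `c`, `J`, `x`:
`geodesicKick c J x = (geodesicDrift 1 (x, c • tangentKick J x)).1`. -/
theorem geodesicKick_eq_fst_geodesicDrift (c : ℝ) (J x : V) :
    geodesicKick c J x = (geodesicDrift 1 (x, c • tangentKick J x)).1 := by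
  simp only [geodesicKick, geodesicDrift, norm_smul, Real.norm_eq_abs, mul_one, smul_smul]
  rw [sin_abs_mul_div_mul c ‖tangentKick J x‖]
  rcases le_or_gt 0 c with h | h
  · rw [abs_of_nonneg h]
  · rw [abs_of_neg h, neg_mul, cos_neg]

/-- The same read the other way: **the kick is the geodesic drift for time `c` with momentum `p`**,
`geodesicKick c J x = (geodesicDrift c (x, tangentKick J x)).1`. -/
theorem geodesicKick_eq_fst_geodesicDrift' (c : ℝ) (J x : V) :
    geodesicKick c J x = (geodesicDrift c (x, tangentKick J x)).1 := by
  simp only [geodesicKick, geodesicDrift, mul_comm (‖tangentKick J x‖) c]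

/-- Consequently the kick keeps unit vectors with tangential `p` on the sphere by the DRIFT's
conservation law (`SphereGeodesicDrift.norm_fst_geodesicDrift`) — the same fact as
`SphereGeodesicKick.norm_geodesicKick`, now inherited rather than recomputed. -/
theorem norm_geodesicKick_of_drift (c : ℝ) (J : V) {x : V} (hx : ‖x‖ = 1) :
    ‖geodesicKick c J x‖ = 1 := by
  rw [geodesicKick_eq_fst_geodesicDrift']
  exact norm_fst_geodesicDrift c hx (inner_self_tangentKick J hx)

end Summit.Ventures.LatticeQCDFlow.Exactness

end
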